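import Summits.Ventures.Crystal3D.Theorems.StickyWulffConstantPolycrystalWulffBoundSlideChimeraTrunc
import Summits.Ventures.Crystal3D.Theorems.StickyWulffConstantPolycrystalWulffBoundTwinSupportGap

/-!
# `PolycrystalWulffBound`, line `PolyDensity`: the NODE ENGINES of the super-grain tree
# (crux `stmt-Ventures-19482`)

Route `StickyWulffConstant` of the venture `Summits/Ventures/Crystal3D`, second prover lane (poly-p2,
gen 13).  `superTree_chimera_lower'` (`…SuperTreeChimeraMeas`) takes the per-node chimera bound as a
hypothesis (`hnode`).  This file supplies the two dischargers and the geometric facts the rung needs: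
* `superNode_bound_sameBody` — a node all of whose cells have ONE body (no internal twin walls): plain
  Brunn–Minkowski for measurable cells and ANY measurable truncation `H` (via the fibre engine with one
  body, so no measurability of a Minkowski sum is needed);
* `superNode_bound_slide` — a single-axis twin node (cells co-axial with the node's reference frame about
  `m`, bond/mirror `u`, slide direction `w ⊥ m, u`, `w`-separation of differently-bodied cells at range
  `r·2/√6`) and a `w`-INVARIANT truncation: `slide_chimera_lower_trunc` re-indexed to the cells of one node;
* `cruxWulffBody_reflection_image_eq_of_triple` — `R_m '' W(A₀) = R_w '' W(A₀)` (the twin body is the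
  reference body mirrored across `w^⊥`, because `R_m ∘ R_w = −R_u` and `−R_u` is a symmetry of `W(A₀)`);
* `volume_cruxWulffBody_inter_eq_of_coaxial_perp_w` — hence every body of a slid node has the SAME cap
  volumes as the reference body along any wall normal `n ⊥ w` (profile transfer inside a node: the tree's
  `hprof` may be checked on the reference frames);
* `sortWindow_add_smul_mem` / `measurableSet_sortWindow` — the tree's truncation window
  `H_f(c) = ⋂_{children i} {⟪y, n i⟫ ≤ c i} ∩ ⋂_{own edge i} {c i < ⟪y, n i⟫}` is `w`-invariant when every
  incident normal is `⊥ w`, and measurable.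
WHAT THIS IS NOT: the rung (next file); the crux is not claimed.
-/

noncomputable section

open scoped BigOperators InnerProductSpace ENNReal Pointwise
open MeasureTheory Set

namespace Summit.Ventures.Crystal3D.Theorems

open Summit.Ventures.Crystal3D.Cruxes.TextureLiminf.TexShadow (E3)
open Literature.MathematicalPhysics.StatisticalMechanics (fccStacking barlowStacking IsHaggSeq)

/-- **`R_m '' W(A₀) = R_w '' W(A₀)`** for an orthonormal triple `(u, w, m)` with `u` a mirror normal of the
lattice `A₀ Λ₀`: `R_m = −R_u ∘ R_w` and `−R_u` preserves `W(A₀)`. -/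
theorem cruxWulffBody_reflection_image_eq_of_triple {m u w : E3} {A₀ : E3 ≃ₗᵢ[ℝ] E3}
    (hm : ‖m‖ = 1) (hu : ‖u‖ = 1) (hw : ‖w‖ = 1) (hum : ⟪u, m⟫_ℝ = 0) (hwm : ⟪w, m⟫_ℝ = 0)
    (hwu : ⟪w, u⟫_ℝ = 0)
    (hmir : (ℝ ∙ u)ᗮ.reflection '' (A₀ '' fccStacking 1 (Real.sqrt (2 / 3))) =
      A₀ '' fccStacking 1 (Real.sqrt (2 / 3))) :
    (ℝ ∙ m)ᗮ.reflection '' {y : E3 | ∀ ν : E3, ⟪y, ν⟫_ℝ ≤ Real.sqrt 2 / 4 *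
        ∑ᶠ w ∈ {w | w ∈ fccStacking 1 (Real.sqrt (2 / 3)) ∧ ‖w‖ = 1}, |⟪w, A₀.symm ν⟫_ℝ|} =
      (ℝ ∙ w)ᗮ.reflection '' {y : E3 | ∀ ν : E3, ⟪y, ν⟫_ℝ ≤ Real.sqrt 2 / 4 *
        ∑ᶠ w ∈ {w | w ∈ fccStacking 1 (Real.sqrt (2 / 3)) ∧ ‖w‖ = 1}, |⟪w, A₀.symm ν⟫_ℝ|} := by
  set B₀ : Set E3 := {y : E3 | ∀ ν : E3, ⟪y, ν⟫_ℝ ≤ Real.sqrt 2 / 4 *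
    ∑ᶠ w ∈ {w | w ∈ fccStacking 1 (Real.sqrt (2 / 3)) ∧ ‖w‖ = 1}, |⟪w, A₀.symm ν⟫_ℝ|} with hB₀
  set Rm : E3 ≃ₗᵢ[ℝ] E3 := (ℝ ∙ m)ᗮ.reflection with hRm
  set Ru : E3 ≃ₗᵢ[ℝ] E3 := (ℝ ∙ u)ᗮ.reflection with hRu
  set Rw : E3 ≃ₗᵢ[ℝ] E3 := (ℝ ∙ w)ᗮ.reflection with hRw
  have himg : ∀ (K : Submodule ℝ E3) (S : Set E3), K.reflection '' S = K.reflection ⁻¹' S :=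
    fun K S => congrFun (Set.image_eq_preimage_of_inverse (fun x => K.reflection_reflection x)
      (fun x => K.reflection_reflection x)) S
  have hRuB₀ : Ru '' B₀ = B₀ := cruxWulffBody_image_eq_of_latticeSymm hmir
  have hnegB₀ : -B₀ = B₀ := by rw [hB₀]; exact neg_cruxWulffBody_eq _
  have hnegmem : ∀ y : E3, -y ∈ B₀ ↔ y ∈ B₀ := fun y => by
    conv_lhs => rw [← hnegB₀]
    exact Set.neg_mem_neg
  have hRumem : ∀ y : E3, Ru y ∈ B₀ ↔ y ∈ B₀ := fun y => by
    conv_lhs => rw [← hRuB₀, himg]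
    rw [mem_preimage, hRu, Submodule.reflection_reflection]
  -- `R_m x = −R_u (R_w x)`
  have hkey : ∀ x : E3, Rm x = -(Ru (Rw x)) := by
    intro x
    have h := reflection_m_sub_two_inner_eq_neg_reflection_u hu hw hm hum hwm hwu (Rw x)
    have hRw2 : Rw x - (2 * ⟪Rw x, w⟫_ℝ) • w = x := by
      rw [real_inner_comm, ← reflection_orthogonal_unit_apply hw, hRw, Submodule.reflection_reflection]
    rw [hRw2] at h
    exact h
  rw [himg, himg]
  ext x
  rw [mem_preimage, mem_preimage, hkey, hnegmem, hRumem]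

/-- **Profile transfer inside a slid node.**  If `A` is co-axial with the reference frame `A₀` about `m`
(crux clause `Ax m A₀ A`), `(u, w, m)` is an orthonormal triple with `u` a mirror normal of `A₀ Λ₀`, and
the unit wall normal `n` is `⊥ w`, then `W(A)` and `W(A₀)` have the same cap volumes along `n`:
`W(A) ∈ {W(A₀), R_m W(A₀) = R_w W(A₀)}` and `R_w` fixes `n`. -/
theorem volume_cruxWulffBody_inter_eq_of_coaxial_perp_w {m u w n : E3} {A₀ A : E3 ≃ₗᵢ[ℝ] E3}
    (h : ∃ (L : E3 ≃ₗᵢ[ℝ] E3) (s₁ s₂ : E3) (σ σ' : ℤ → ℤ), IsHaggSeq σ ∧ IsHaggSeq σ' ∧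
      L (EuclideanSpace.single (2 : Fin 3) (1 : ℝ)) = m ∧
      A₀ '' fccStacking 1 (Real.sqrt (2 / 3)) ⊆
        (fun q => L q + s₁) '' barlowStacking 1 (Real.sqrt (2 / 3)) σ ∧
      A '' fccStacking 1 (Real.sqrt (2 / 3)) ⊆
        (fun q => L q + s₂) '' barlowStacking 1 (Real.sqrt (2 / 3)) σ')
    (hu : ‖u‖ = 1) (hw : ‖w‖ = 1) (hum : ⟪u, m⟫_ℝ = 0) (hwm : ⟪w, m⟫_ℝ = 0) (hwu : ⟪w, u⟫_ℝ = 0)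
    (hmir : (ℝ ∙ u)ᗮ.reflection '' (A₀ '' fccStacking 1 (Real.sqrt (2 / 3))) =
      A₀ '' fccStacking 1 (Real.sqrt (2 / 3)))
    (hn : ⟪n, w⟫_ℝ = 0) (s : ℝ) :
    volume ({y : E3 | ∀ ν : E3, ⟪y, ν⟫_ℝ ≤ Real.sqrt 2 / 4 *
        ∑ᶠ w ∈ {w | w ∈ fccStacking 1 (Real.sqrt (2 / 3)) ∧ ‖w‖ = 1}, |⟪w, A.symm ν⟫_ℝ|} ∩
        {y : E3 | s < ⟪y, n⟫_ℝ}) =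
      volume ({y : E3 | ∀ ν : E3, ⟪y, ν⟫_ℝ ≤ Real.sqrt 2 / 4 *
        ∑ᶠ w ∈ {w | w ∈ fccStacking 1 (Real.sqrt (2 / 3)) ∧ ‖w‖ = 1}, |⟪w, A₀.symm ν⟫_ℝ|} ∩
        {y : E3 | s < ⟪y, n⟫_ℝ}) := by
  have hm : ‖m‖ = 1 := by
    obtain ⟨L, -, -, -, -, -, -, hLm, -, -⟩ := h
    rw [← hLm, LinearIsometryEquiv.norm_map, PiLp.norm_single, norm_one]
  rcases cruxWulffBody_eq_or_eq_reflection_image h with hAB | hAB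
  · rw [hAB]
  · rw [hAB, cruxWulffBody_reflection_image_eq_of_triple hm hu hw hum hwm hwu hmir]
    set R : E3 ≃ₗᵢ[ℝ] E3 := (ℝ ∙ w)ᗮ.reflection with hR
    set WA : Set E3 := {y : E3 | ∀ ν : E3, ⟪y, ν⟫_ℝ ≤ Real.sqrt 2 / 4 *
      ∑ᶠ w ∈ {w | w ∈ fccStacking 1 (Real.sqrt (2 / 3)) ∧ ‖w‖ = 1}, |⟪w, A₀.symm ν⟫_ℝ|} with hWA
    have hnmem : n ∈ (ℝ ∙ w)ᗮ := by
      rw [Submodule.mem_orthogonal_singleton_iff_inner_left]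
      exact hn
    have hRn : R n = n := Submodule.reflection_mem_subspace_eq_self hnmem
    have hinner : ∀ y : E3, ⟪R y, n⟫_ℝ = ⟪y, n⟫_ℝ := by
      intro y
      have h1 : ⟪R y, R n⟫_ℝ = ⟪y, n⟫_ℝ := LinearIsometryEquiv.inner_map_map R y n
      rwa [hRn] at h1
    have hcap : R '' WA ∩ {y : E3 | s < ⟪y, n⟫_ℝ} = R '' (WA ∩ {y : E3 | s < ⟪y, n⟫_ℝ}) := by
      ext z
      simp only [mem_inter_iff, mem_image, mem_setOf_eq]
      constructor
      · rintro ⟨⟨y, hy, rfl⟩, hz⟩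
        exact ⟨y, ⟨hy, by rwa [hinner] at hz⟩, rfl⟩
      · rintro ⟨y, ⟨hy, hz⟩, rfl⟩
        exact ⟨⟨y, hy, rfl⟩, by rwa [hinner]⟩
    have hWAm : MeasurableSet WA := (isCompact_cruxWulffBody A₀).isClosed.measurableSet
    have hlt_m : MeasurableSet {y : E3 | s < ⟪y, n⟫_ℝ} :=
      measurableSet_lt measurable_const (measurable_id.inner measurable_const)
    rw [hcap, LinearIsometryEquiv.image_eq_preimage_symm]
    exact R.symm.measurePreserving.measure_preimage (hWAm.inter hlt_m).nullMeasurableSet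

/-- **Single-body node** (no internal twin walls): if every cell of node `f` has the body `W(Aref)`,
then for ANY measurable truncation `H` and measurable `C ⊇ ⋃_{nd j = f} (G j + r·(W(A j) ∩ H))`,
`|⋃_{nd j = f} G j|^{1/3} + r·|W(Aref) ∩ H|^{1/3} ≤ |C|^{1/3}` (cells merely measurable). -/
theorem superNode_bound_sameBody {N M : ℕ} (nd : Fin M → Fin (N + 1)) (f : Fin (N + 1))
    (G : Fin M → Set E3) (hG : ∀ j, MeasurableSet (G j)) (A : Fin M → (E3 ≃ₗᵢ[ℝ] E3))
    (Aref : E3 ≃ₗᵢ[ℝ] E3)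
    (hsame : ∀ j, nd j = f → {y : E3 | ∀ ν : E3, ⟪y, ν⟫_ℝ ≤ Real.sqrt 2 / 4 *
        ∑ᶠ w ∈ {w | w ∈ fccStacking 1 (Real.sqrt (2 / 3)) ∧ ‖w‖ = 1}, |⟪w, (A j).symm ν⟫_ℝ|} =
      {y : E3 | ∀ ν : E3, ⟪y, ν⟫_ℝ ≤ Real.sqrt 2 / 4 *
        ∑ᶠ w ∈ {w | w ∈ fccStacking 1 (Real.sqrt (2 / 3)) ∧ ‖w‖ = 1}, |⟪w, Aref.symm ν⟫_ℝ|})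
    {r : ℝ} (hr : 0 < r) {H : Set E3} (hHm : MeasurableSet H)
    (h0 : volume (⋃ j, ⋃ (_ : nd j = f), G j) ≠ 0) (htop : volume (⋃ j, ⋃ (_ : nd j = f), G j) ≠ ⊤)
    (hH0 : volume ({y : E3 | ∀ ν : E3, ⟪y, ν⟫_ℝ ≤ Real.sqrt 2 / 4 *
        ∑ᶠ w ∈ {w | w ∈ fccStacking 1 (Real.sqrt (2 / 3)) ∧ ‖w‖ = 1}, |⟪w, Aref.symm ν⟫_ℝ|} ∩ H) ≠ 0)
    {C : Set E3} (hC : MeasurableSet C)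
    (hsub : ∀ j, nd j = f → ∀ x ∈ G j, ∀ y ∈ {y : E3 | ∀ ν : E3, ⟪y, ν⟫_ℝ ≤ Real.sqrt 2 / 4 *
        ∑ᶠ w ∈ {w | w ∈ fccStacking 1 (Real.sqrt (2 / 3)) ∧ ‖w‖ = 1}, |⟪w, (A j).symm ν⟫_ℝ|} ∩ H,
      x + r • y ∈ C) :
    volume (⋃ j, ⋃ (_ : nd j = f), G j) ^ ((3 : ℕ)⁻¹ : ℝ) + ENNReal.ofReal r *
      (volume ({y : E3 | ∀ ν : E3, ⟪y, ν⟫_ℝ ≤ Real.sqrt 2 / 4 *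
        ∑ᶠ w ∈ {w | w ∈ fccStacking 1 (Real.sqrt (2 / 3)) ∧ ‖w‖ = 1}, |⟪w, Aref.symm ν⟫_ℝ|} ∩ H)) ^
        ((3 : ℕ)⁻¹ : ℝ) ≤
      volume C ^ ((3 : ℕ)⁻¹ : ℝ) := by
  set B : Set E3 := {y : E3 | ∀ ν : E3, ⟪y, ν⟫_ℝ ≤ Real.sqrt 2 / 4 *
    ∑ᶠ w ∈ {w | w ∈ fccStacking 1 (Real.sqrt (2 / 3)) ∧ ‖w‖ = 1}, |⟪w, Aref.symm ν⟫_ℝ|} with hB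
  set P : Set E3 := ⋃ j, ⋃ (_ : nd j = f), G j with hP
  have hPm : MeasurableSet P := MeasurableSet.iUnion fun j => MeasurableSet.iUnion fun _ => hG j
  have hBc : IsCompact B := isCompact_cruxWulffBody Aref
  have hBHm : MeasurableSet (r • (B ∩ H)) := (hBc.isClosed.measurableSet.inter hHm).const_smul₀ r
  -- standard coordinates
  set T : E3 ≃ᵐ (Fin 3 → ℝ) := (MeasurableEquiv.toLp 2 (Fin 3 → ℝ)).symm with hT
  have hTmp : MeasurePreserving T volume volume :=
    EuclideanSpace.volume_preserving_symm_measurableEquiv_toLp (Fin 3)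
  have hTvol : ∀ X : Set E3, MeasurableSet X → volume (T '' X) = volume X := fun X hX => by
    rw [MeasurableEquiv.image_eq_preimage_symm]; exact hTmp.symm.measure_preimage hX.nullMeasurableSet
  have hTadd : ∀ x y : E3, T (x + y) = T x + T y := fun x y => rfl
  set W₀ : Set (Fin 3 → ℝ) := T '' (r • (B ∩ H)) with hW₀
  have hW₀m : MeasurableSet W₀ := (MeasurableEquiv.measurableSet_image _).2 hBHm
  have hvW₀ : volume W₀ = ENNReal.ofReal (r ^ 3) * volume (B ∩ H) := by
    rw [hW₀, hTvol _ hBHm, Measure.addHaar_smul, finrank_euclideanSpace, Fintype.card_fin,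
      abs_of_pos (pow_pos hr 3)]
  have hBHfin : volume (B ∩ H) ≠ ⊤ :=
    (lt_of_le_of_lt (measure_mono inter_subset_left) hBc.measure_lt_top).ne
  have hchim := Chimera.chimera3_multiBody_brunnMinkowski (N := 1) (fun _ => T '' P) (fun _ => W₀)
    (W₀ := W₀) (C := T '' C) (fun _ _ _ => 0)
    (fun _ => (MeasurableEquiv.measurableSet_image _).2 hPm)
    ((MeasurableEquiv.measurableSet_image _).2 hC) hW₀m
    (fun j j' h => absurd (Subsingleton.elim j j') h)
    (fun _ _ _ y hy => by rw [add_zero]; exact hy)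
    (fun j j' h => absurd (Subsingleton.elim j j') h)
    (by
      rintro - a ⟨x, hx, rfl⟩ w' ⟨v', hv', rfl⟩
      obtain ⟨y', hy', rfl⟩ := Set.mem_smul_set.1 hv'
      obtain ⟨j, hj, hxj⟩ : ∃ j, nd j = f ∧ x ∈ G j := by
        simpa only [hP, mem_iUnion, exists_prop] using hx
      refine ⟨x + r • y', hsub j hj x hxj y' ⟨?_, hy'.2⟩, rfl⟩
      rw [hsame j hj]; exact hy'.1)
    (by rw [iUnion_const, hTvol _ hPm]; exact h0) (by rw [iUnion_const, hTvol _ hPm]; exact htop)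
    (by rw [hvW₀]; exact mul_ne_zero (ENNReal.ofReal_pos.2 (by positivity)).ne' hH0)
    (by rw [hvW₀]; exact ENNReal.mul_ne_top ENNReal.ofReal_ne_top hBHfin)
  have hroot : (ENNReal.ofReal (r ^ 3) * volume (B ∩ H)) ^ ((3 : ℕ)⁻¹ : ℝ) =
      ENNReal.ofReal r * volume (B ∩ H) ^ ((3 : ℕ)⁻¹ : ℝ) := by
    rw [ENNReal.mul_rpow_of_nonneg _ _ (by positivity), ENNReal.ofReal_rpow_of_nonneg (by positivity)
      (by positivity), Real.pow_rpow_inv_natCast hr.le (by norm_num)]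
  rw [iUnion_const, hTvol _ hPm, hTvol _ hC, hvW₀, hroot] at hchim
  exact hchim

/-- **Slid node** (single-axis twin network): cells of node `f` co-axial with the reference frame
`Aref` about `m`, bond/mirror `u` of `Aref Λ₀`, `w ⊥ m, u`, `w`-separation of differently-bodied cells
at range `r·2/√6`, a measurable `w`-INVARIANT truncation `H` with `|W(Aref) ∩ H| ≠ 0`, and a measurable
`C ⊇ ⋃_{nd j = f} (G j + r·(W(A j) ∩ H))`: `|⋃_{nd j = f} G j|^{1/3} + r·|W(Aref) ∩ H|^{1/3} ≤ |C|^{1/3}`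
(`slide_chimera_lower_trunc` re-indexed to one node). -/
theorem superNode_bound_slide {N M : ℕ} (nd : Fin M → Fin (N + 1)) (f : Fin (N + 1))
    (m u w : E3) (hu : ‖u‖ = 1) (hw : ‖w‖ = 1) (hum : ⟪u, m⟫_ℝ = 0) (hwm : ⟪w, m⟫_ℝ = 0)
    (hwu : ⟪w, u⟫_ℝ = 0) (Aref : E3 ≃ₗᵢ[ℝ] E3)
    (hbond : u ∈ Aref '' fccStacking 1 (Real.sqrt (2 / 3)))
    (hmir : (ℝ ∙ u)ᗮ.reflection '' (Aref '' fccStacking 1 (Real.sqrt (2 / 3))) =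
      Aref '' fccStacking 1 (Real.sqrt (2 / 3)))
    (G : Fin M → Set E3) (hG : ∀ j, MeasurableSet (G j))
    (hdisj : ∀ j j', j ≠ j' → Disjoint (G j) (G j')) (A : Fin M → (E3 ≃ₗᵢ[ℝ] E3))
    (hAx : ∀ j, nd j = f → ∃ (L : E3 ≃ₗᵢ[ℝ] E3) (s₁ s₂ : E3) (σ σ' : ℤ → ℤ),
      IsHaggSeq σ ∧ IsHaggSeq σ' ∧ L (EuclideanSpace.single (2 : Fin 3) (1 : ℝ)) = m ∧
      Aref '' fccStacking 1 (Real.sqrt (2 / 3)) ⊆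
        (fun q => L q + s₁) '' barlowStacking 1 (Real.sqrt (2 / 3)) σ ∧
      A j '' fccStacking 1 (Real.sqrt (2 / 3)) ⊆
        (fun q => L q + s₂) '' barlowStacking 1 (Real.sqrt (2 / 3)) σ')
    {r : ℝ} (hr : 0 < r)
    (hsep : ∀ j j', nd j = f → nd j' = f → {y : E3 | ∀ ν : E3, ⟪y, ν⟫_ℝ ≤ Real.sqrt 2 / 4 *
        ∑ᶠ w ∈ {w | w ∈ fccStacking 1 (Real.sqrt (2 / 3)) ∧ ‖w‖ = 1}, |⟪w, (A j).symm ν⟫_ℝ|} ≠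
      {y : E3 | ∀ ν : E3, ⟪y, ν⟫_ℝ ≤ Real.sqrt 2 / 4 *
        ∑ᶠ w ∈ {w | w ∈ fccStacking 1 (Real.sqrt (2 / 3)) ∧ ‖w‖ = 1}, |⟪w, (A j').symm ν⟫_ℝ|} →
      ∀ x ∈ G j, ∀ t : ℝ, |t| ≤ r * (2 / Real.sqrt 6) → x + t • w ∉ G j')
    {H : Set E3} (hHm : MeasurableSet H) (hHw : ∀ y ∈ H, ∀ t : ℝ, y + t • w ∈ H)
    (h0 : volume (⋃ j, ⋃ (_ : nd j = f), G j) ≠ 0) (htop : volume (⋃ j, ⋃ (_ : nd j = f), G j) ≠ ⊤)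
    (hH0 : volume ({y : E3 | ∀ ν : E3, ⟪y, ν⟫_ℝ ≤ Real.sqrt 2 / 4 *
        ∑ᶠ w ∈ {w | w ∈ fccStacking 1 (Real.sqrt (2 / 3)) ∧ ‖w‖ = 1}, |⟪w, Aref.symm ν⟫_ℝ|} ∩ H) ≠ 0)
    {C : Set E3} (hC : MeasurableSet C)
    (hsub : ∀ j, nd j = f → ∀ x ∈ G j, ∀ y ∈ {y : E3 | ∀ ν : E3, ⟪y, ν⟫_ℝ ≤ Real.sqrt 2 / 4 *
        ∑ᶠ w ∈ {w | w ∈ fccStacking 1 (Real.sqrt (2 / 3)) ∧ ‖w‖ = 1}, |⟪w, (A j).symm ν⟫_ℝ|} ∩ H,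
      x + r • y ∈ C) :
    volume (⋃ j, ⋃ (_ : nd j = f), G j) ^ ((3 : ℕ)⁻¹ : ℝ) + ENNReal.ofReal r *
      (volume ({y : E3 | ∀ ν : E3, ⟪y, ν⟫_ℝ ≤ Real.sqrt 2 / 4 *
        ∑ᶠ w ∈ {w | w ∈ fccStacking 1 (Real.sqrt (2 / 3)) ∧ ‖w‖ = 1}, |⟪w, Aref.symm ν⟫_ℝ|} ∩ H)) ^
        ((3 : ℕ)⁻¹ : ℝ) ≤
      volume C ^ ((3 : ℕ)⁻¹ : ℝ) := by
  classical
  -- re-index the cells of node `f` by `Fin k`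
  set ι := {j : Fin M // nd j = f} with hι
  set k : ℕ := Fintype.card ι with hk
  set e : Fin k ≃ ι := (Fintype.equivFin ι).symm with he
  set G' : Fin k → Set E3 := fun i => G (e i).1 with hG'
  set A' : Fin k → (E3 ≃ₗᵢ[ℝ] E3) := fun i => A (e i).1 with hA'
  have hU : (⋃ i, G' i) = ⋃ j, ⋃ (_ : nd j = f), G j := by
    ext x
    simp only [hG', mem_iUnion, exists_prop]
    constructor
    · rintro ⟨i, hx⟩; exact ⟨(e i).1, (e i).2, hx⟩
    · rintro ⟨j, hj, hx⟩
      refine ⟨e.symm ⟨j, hj⟩, ?_⟩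
      rw [Equiv.apply_symm_apply]; exact hx
  have hinj : ∀ i i' : Fin k, i ≠ i' → (e i).1 ≠ (e i').1 := fun i i' h h' =>
    h (e.injective (Subtype.ext h'))
  have h := slide_chimera_lower_trunc m u w hu hw hum hwm hwu Aref hbond hmir G' (fun i => hG _)
    (fun i i' h => hdisj _ _ (hinj i i' h)) A' (fun i => hAx _ (e i).2) hr
    (fun i i' hne x hx t ht => hsep _ _ (e i).2 (e i').2 hne x hx t ht)
    (by rw [hU]; exact h0) (by rw [hU]; exact htop) hHm hHw hH0 hC
    (fun i x hx y hy => hsub _ (e i).2 x hx y hy)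
  rw [hU] at h
  exact h

/-- The tree's truncation window `⋂_{par i = f} {⟪y, n i⟫ ≤ c i} ∩ ⋂_{f = i.succ} {c i < ⟪y, n i⟫}` is
invariant under translations along `w` when every incident edge normal is `⊥ w`. -/
theorem sortWindow_add_smul_mem {N : ℕ} (par : Fin N → Fin (N + 1)) (f : Fin (N + 1))
    (n : Fin N → E3) (c : Fin N → ℝ) (w : E3) (hpar : ∀ i, par i = f → ⟪n i, w⟫_ℝ = 0)
    (hown : ∀ i, f = i.succ → ⟪n i, w⟫_ℝ = 0) :
    ∀ y ∈ (⋂ i ∈ Finset.univ.filter (fun i => par i = f), {y : E3 | ⟪y, n i⟫_ℝ ≤ c i}) ∩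
        ⋂ i ∈ Finset.univ.filter (fun i : Fin N => f = i.succ), {y : E3 | c i < ⟪y, n i⟫_ℝ},
      ∀ t : ℝ, y + t • w ∈ (⋂ i ∈ Finset.univ.filter (fun i => par i = f),
          {y : E3 | ⟪y, n i⟫_ℝ ≤ c i}) ∩
        ⋂ i ∈ Finset.univ.filter (fun i : Fin N => f = i.succ), {y : E3 | c i < ⟪y, n i⟫_ℝ} := by
  intro y hy t
  simp only [mem_inter_iff, mem_iInter, Finset.mem_filter, Finset.mem_univ, true_and,
    mem_setOf_eq] at hy ⊢
  have hshift : ∀ i, ⟪n i, w⟫_ℝ = 0 → ⟪y + t • w, n i⟫_ℝ = ⟪y, n i⟫_ℝ := by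
    intro i hi
    rw [inner_add_left, real_inner_smul_left, real_inner_comm (n i) w, hi, mul_zero, add_zero]
  exact ⟨fun i hi => by rw [hshift i (hpar i hi)]; exact hy.1 i hi,
    fun i hi => by rw [hshift i (hown i hi)]; exact hy.2 i hi⟩

/-- The tree's truncation window is measurable. -/
theorem measurableSet_sortWindow {N : ℕ} (par : Fin N → Fin (N + 1)) (f : Fin (N + 1))
    (n : Fin N → E3) (c : Fin N → ℝ) :
    MeasurableSet ((⋂ i ∈ Finset.univ.filter (fun i => par i = f), {y : E3 | ⟪y, n i⟫_ℝ ≤ c i}) ∩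
        ⋂ i ∈ Finset.univ.filter (fun i : Fin N => f = i.succ), {y : E3 | c i < ⟪y, n i⟫_ℝ}) :=
  (Finset.measurableSet_biInter _ fun _ _ =>
      measurableSet_le (measurable_id.inner measurable_const) measurable_const).inter
    (Finset.measurableSet_biInter _ fun _ _ =>
      measurableSet_lt measurable_const (measurable_id.inner measurable_const))

end Summit.Ventures.Crystal3D.Theorems

end
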